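import Mathlib.Analysis.Calculus.Deriv.MeanValue
import Literature.Probability.RandomPlanarGeometry.SLETwoPointMartingale
import Literature.Probability.RandomPlanarGeometry.LoewnerChainProofs
import Literature.Probability.RandomPlanarGeometry.LoewnerFlow
import HarnessLib

/-!
# The two-point real Loewner flow: the pathwise facts behind Lawler's Prop. 6.33

Topic `Probability/RandomPlanarGeometry`; theorems only (sibling proof file of
`SLETwoPointMartingale`). For a *continuous* driving function `W` and two real points
`y < W₀ < x` we study, with `Xₜ = gₜ(x) - Wₜ`, `Yₜ = gₜ(y) - Wₜ` (`Loewner.realFlow`),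
`Zₜ = Xₜ/(Xₜ - Yₜ)` (`Loewner.twoPointRatio`) and `σ = T_x ⊓ T_y` (`Loewner.twoPointTime`), the
deterministic content of the proof of Lawler (2005), Prop. 6.33 (and of §1.10):

* `Xₜ > 0 > Yₜ` for `t < T_x`, resp. `t < T_y` (`realFlow_pos`, `realFlow_neg`), hence
  `Zₜ ∈ (0, 1)` for `t < σ` (`twoPointRatio_mem_Ioo`); `Z₀ = (x - W₀)/(x - y)`; `0 < σ`;
* the reflection symmetry `(W, x, y) ↦ (-W, -y, -x)`: `X ↦ -Y`, `Z ↦ 1 - Z`, `σ ↦ σ`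
  (`map_neg_conj`, `realFlow_neg_driving`, `twoPointRatio_reflect`) — Lawler's "symmetry about
  the imaginary axis";
* `d(X - Y) = (2/X - 2/Y) dt > 0`: the gap `Xₜ - Yₜ = gₜ(x) - gₜ(y)` is non-decreasing on `[0, σ)`
  (`realFlow_sub_realFlow_mono`), so `Xₜ - Yₜ ≥ x - y`;
* the swallowed point reaches the driving function: if `T_x = b < ∞` then `Xₜ → 0` as `t ↑ b`
  (`realFlow_lt_of_near_swallowingTime`; Lawler (2005), p. 154 / §4.1: "`T_z` satisfies
  `lim_{t→T_z-} ĝₜ(z) - … = 0`", here from the extension criterion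
  `IsSolution.coe_lt_swallowingTime_of_le_norm_sub` of `LoewnerChainProofs`, monotonicity of
  `gₜ(x)` and uniform continuity of `W`);
* consequently `Zₜ → 0` as `t ↑ T_x` when `T_x ≤ T_y`, `Zₜ → 1` as `t ↑ T_y` when `T_y ≤ T_x`
  (`twoPointRatio_lt_of_near`, `one_sub_twoPointRatio_lt_of_near`), and **`T_x ≠ T_y` whenever
  `σ < ∞`** (`swallowingTime_ne_swallowingTime`): the two points on opposite sides of the driving
  point are never swallowed simultaneously ("`σ` = the first time `Zₜ ∈ {0, 1}`" is unambiguous);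
* for the SLE_κ driving function `√κ B(ω)` (`W₀ = 0`): the two-point observable
  `Literature.sleTwoPointObservable κ x y` of `SLETwoPointMartingale` takes values in `[0, 1]`
  for `κ > 4` is not proved here (it needs `swallowingProb ∈ [0,1]`, `SwallowingProbCalculus`);
  here: its value at time `0` (`sleTwoPointObservable_zero`) and its eventual value
  `𝟙{T_y < T_x}` (`sleTwoPointObservable_of_le_*` of the defining file).

These feed the assembly `sle_measureReal_swallowingTime_lt_of_martingale`
(`SLECrossingProbabilityProofs`).

## References

* G. F. Lawler, *Conformally Invariant Processes in the Plane*, AMS (2005): §4.1 (real points,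
  `T_x`), §1.10 (proof of Prop. 1.21), §6.7 (proof of Prop. 6.33).
-/

noncomputable section

open Set Filter Topology Complex
open scoped NNReal

namespace Literature.Probability.RandomPlanarGeometry

namespace Loewner

variable {W : ℝ≥0 → ℝ}

/-! ### The real flow along a solution; sign -/

/-- Along any solution `g` from the real point `x` alive at time `t`,
`realFlow W x t = re (g t) - W t`. [folklore] -/
theorem realFlow_eq_re_sub (hW : Continuous W) {x : ℝ} {g : ℝ → ℂ} {T : WithTop ℝ≥0}
    (h : IsSolution W x g T) {t : ℝ≥0} (ht : (t : WithTop ℝ≥0) < T) :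
    realFlow W x t = (g t).re - W t := by
  rw [realFlow, map_eq_of_isSolution hW h ht]

/-- At time `0`, `X₀ = x - W₀` (for `x ≠ W₀`). [folklore] -/
theorem realFlow_zero (hW : Continuous W) {x : ℝ} (hx : x ≠ W 0) : realFlow W x 0 = x - W 0 := by
  have hx' : (x : ℂ) ≠ W 0 := fun h ↦ hx (by exact_mod_cast h)
  rw [realFlow, map_zero_apply hW hx', ofReal_re]

/-- **A real point to the right of the driving point has `Xₜ > 0`** for `t < T_x`
(`IsSolution.driving_lt_re`; Lawler (2005), §4.1 / §1.10). [cite: Lawler2005, Ch. 4 §4.1] -/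
theorem realFlow_pos (hW : Continuous W) {x : ℝ} (hx : W 0 < x) {t : ℝ≥0}
    (ht : (t : WithTop ℝ≥0) < swallowingTime W x) : 0 < realFlow W x t := by
  have hx' : (x : ℂ) ≠ W 0 := fun h ↦ hx.ne' (by exact_mod_cast h)
  obtain ⟨g, hg⟩ := exists_isSolution_swallowingTime_holds hW hx'
  rw [realFlow_eq_re_sub hW hg ht, sub_pos]
  have := hg.driving_lt_re hW hx (t := (t : ℝ)) t.coe_nonneg (by simpa using ht)
  simpa using this

/-- **Reflection symmetry of the Loewner map**: `map (-W) t (-z̄) = -conj (map W t z)` for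
`t < T_z` (from `IsSolution.neg_conj`). Lawler (2005), §6.2 (symmetry `x ↦ -x` of chordal SLE).
[cite: Lawler2005, Ch. 4 §4.1] -/
theorem map_neg_conj (hW : Continuous W) {z : ℂ} {t : ℝ≥0}
    (ht : (t : WithTop ℝ≥0) < swallowingTime W z) :
    map (fun s ↦ -W s) t (-(starRingEnd ℂ z)) = -(starRingEnd ℂ (map W t z)) := by
  have hz : z ≠ W 0 := ne_driving_of_lt_swallowingTime ht
  obtain ⟨g, hg⟩ := exists_isSolution_swallowingTime_holds hW hz
  rw [map_eq_of_isSolution hW hg ht,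
    map_eq_of_isSolution (W := fun s ↦ -W s) (hW.neg : Continuous fun s ↦ -W s) hg.neg_conj ht]

/-- Under the reflection `(W, x) ↦ (-W, -x)` the real flow changes sign:
`realFlow (-W) (-x) t = -realFlow W x t` for `t < T_x`. [folklore] -/
theorem realFlow_neg_driving (hW : Continuous W) {x : ℝ} {t : ℝ≥0}
    (ht : (t : WithTop ℝ≥0) < swallowingTime W x) :
    realFlow (fun s ↦ -W s) (-x) t = -realFlow W x t := by
  have h1 : ((-x : ℝ) : ℂ) = -(starRingEnd ℂ (x : ℂ)) := by simp
  rw [realFlow, realFlow, h1, map_neg_conj hW ht]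
  simp only [neg_re, conj_re]
  ring

/-- **A real point to the left of the driving point has `Yₜ < 0`** for `t < T_y` (reflection of
`realFlow_pos`). [cite: Lawler2005, Ch. 4 §4.1] -/
theorem realFlow_neg (hW : Continuous W) {y : ℝ} (hy : y < W 0) {t : ℝ≥0}
    (ht : (t : WithTop ℝ≥0) < swallowingTime W y) : realFlow W y t < 0 := by
  have hy' : (fun s ↦ -W s) 0 < -y := by simpa using hy
  have ht' : (t : WithTop ℝ≥0) < swallowingTime (fun s ↦ -W s) ((-y : ℝ) : ℂ) := by
    rwa [swallowingTime_neg_ofReal]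
  have h := realFlow_pos (W := fun s ↦ -W s) (hW.neg : Continuous fun s ↦ -W s) hy' ht'
  rw [realFlow_neg_driving hW ht] at h
  linarith

/-! ### Lawler's ratio `Z = X/(X - Y)` before `σ` -/

/-- `0 < σ`: both points flow for a positive time (`y < W₀ < x`). [folklore] -/
theorem twoPointTime_pos (hW : Continuous W) {x y : ℝ} (hx : W 0 < x) (hy : y < W 0) :
    0 < twoPointTime W x y := by
  have hx' : (x : ℂ) ≠ W 0 := fun h ↦ hx.ne' (by exact_mod_cast h)
  have hy' : (y : ℂ) ≠ W 0 := fun h ↦ hy.ne (by exact_mod_cast h)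
  exact lt_min (swallowingTime_pos_holds hW hx') (swallowingTime_pos_holds hW hy')

/-- **`Zₜ ∈ (0, 1)` for `t < σ`** (`Xₜ > 0 > Yₜ`). Lawler (2005), proof of Prop. 6.33.
[cite: Lawler2005, Prop. 6.33] -/
theorem twoPointRatio_mem_Ioo (hW : Continuous W) {x y : ℝ} (hx : W 0 < x) (hy : y < W 0)
    {t : ℝ≥0} (ht : (t : WithTop ℝ≥0) < twoPointTime W x y) :
    twoPointRatio W x y t ∈ Ioo (0 : ℝ) 1 := by
  obtain ⟨htx, hty⟩ := coe_lt_twoPointTime_iff.1 ht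
  have hX := realFlow_pos hW hx htx
  have hY := realFlow_neg hW hy hty
  have hQ : 0 < realFlow W x t - realFlow W y t := by linarith
  refine ⟨div_pos hX hQ, (div_lt_one hQ).2 (by linarith)⟩

/-- `Zₜ ∈ [0, 1]` for `t < σ`. [cite: Lawler2005, Prop. 6.33] -/
theorem twoPointRatio_mem_Icc (hW : Continuous W) {x y : ℝ} (hx : W 0 < x) (hy : y < W 0)
    {t : ℝ≥0} (ht : (t : WithTop ℝ≥0) < twoPointTime W x y) :
    twoPointRatio W x y t ∈ Icc (0 : ℝ) 1 :=
  Ioo_subset_Icc_self (twoPointRatio_mem_Ioo hW hx hy ht)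

/-- **`Z₀ = (x - W₀)/(x - y)`** (`= x/(x+|y|)` when `W₀ = 0`). Lawler (2005), proof of Prop. 6.33
(`Z₀ = 1/(1+y)` for the points `1`, `-y`). [cite: Lawler2005, Prop. 6.33] -/
theorem twoPointRatio_zero (hW : Continuous W) {x y : ℝ} (hx : W 0 < x) (hy : y < W 0) :
    twoPointRatio W x y 0 = (x - W 0) / (x - y) := by
  rw [twoPointRatio, realFlow_zero hW hx.ne', realFlow_zero hW hy.ne]
  ring_nf

/-- **Reflection `Z ↦ 1 - Z`**: under `(W, x, y) ↦ (-W, -y, -x)` Lawler's ratio becomes `1 - Z`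
for `t < σ` ("symmetry about the imaginary axis", proof of Prop. 6.33). [cite: Lawler2005, Prop. 6.33] -/
theorem twoPointRatio_reflect (hW : Continuous W) {x y : ℝ} (hx : W 0 < x) (hy : y < W 0)
    {t : ℝ≥0} (ht : (t : WithTop ℝ≥0) < twoPointTime W x y) :
    twoPointRatio (fun s ↦ -W s) (-y) (-x) t = 1 - twoPointRatio W x y t := by
  obtain ⟨htx, hty⟩ := coe_lt_twoPointTime_iff.1 ht
  have hX := realFlow_pos hW hx htx
  have hY := realFlow_neg hW hy hty
  have hQ : realFlow W x t - realFlow W y t ≠ 0 := by linarith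
  rw [twoPointRatio, twoPointRatio, realFlow_neg_driving hW hty, realFlow_neg_driving hW htx,
    show -realFlow W y t - -realFlow W x t = realFlow W x t - realFlow W y t by ring,
    eq_sub_iff_add_eq, ← add_div,
    show -realFlow W y t + realFlow W x t = realFlow W x t - realFlow W y t by ring, div_self hQ]

/-- The two-point time is invariant under the reflection `(W, x, y) ↦ (-W, -y, -x)`. [folklore] -/
theorem twoPointTime_reflect (W : ℝ≥0 → ℝ) (x y : ℝ) :
    twoPointTime (fun s ↦ -W s) (-y) (-x) = twoPointTime W x y := by
  rw [twoPointTime, twoPointTime, swallowingTime_neg_ofReal, swallowingTime_neg_ofReal, min_comm]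

/-! ### The gap `X - Y = g(x) - g(y)` is non-decreasing -/

/-- The real part of a solution is differentiable in time, with derivative `2/(re g - W)` while
the solution is real. [folklore] -/
theorem IsSolution.hasDerivAt_re {x : ℝ} {g : ℝ → ℂ} {T : WithTop ℝ≥0}
    (h : IsSolution W x g T) {u : ℝ} (hu0 : 0 < u) (huT : (u.toNNReal : WithTop ℝ≥0) < T) :
    HasDerivAt (fun s ↦ (g s).re) (2 / ((g u).re - W u.toNNReal)) u := by
  have h1 := h.hasDerivAt hu0 huT
  have h2 : HasDerivAt (fun s ↦ (g s).re) (reCLM (vectorField W u (g u))) u :=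
    reCLM.hasFDerivAt.comp_hasDerivAt u h1
  have him : (g u).im = 0 := IsSolution.im_eq_zero_holds h (ofReal_im x) u hu0.le huT
  rwa [reCLM_apply, re_vectorField_of_im_eq_zero W u him] at h2

/-- **The gap `Xₜ - Yₜ = gₜ(x) - gₜ(y)` is non-decreasing on `[0, σ)`**: its time derivative is
`2/X - 2/Y > 0` (`X > 0 > Y`). Lawler (2005), proof of Prop. 6.33:
`d[X_t - Y_t] = [a/X_t - a/Y_t] dt`. [cite: Lawler2005, Prop. 6.33] -/
theorem realFlow_sub_realFlow_mono (hW : Continuous W) {x y : ℝ} (hx : W 0 < x) (hy : y < W 0)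
    {s t : ℝ≥0} (hst : s ≤ t) (ht : (t : WithTop ℝ≥0) < twoPointTime W x y) :
    realFlow W x s - realFlow W y s ≤ realFlow W x t - realFlow W y t := by
  obtain ⟨htx, hty⟩ := coe_lt_twoPointTime_iff.1 ht
  have hx' : (x : ℂ) ≠ W 0 := fun h ↦ hx.ne' (by exact_mod_cast h)
  have hy' : (y : ℂ) ≠ W 0 := fun h ↦ hy.ne (by exact_mod_cast h)
  obtain ⟨g, hg⟩ := exists_isSolution_swallowingTime_holds hW hx'
  obtain ⟨g', hg'⟩ := exists_isSolution_swallowingTime_holds hW hy'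
  have hsx : (s : WithTop ℝ≥0) < swallowingTime W x := lt_of_le_of_lt (WithTop.coe_le_coe.2 hst) htx
  have hsy : (s : WithTop ℝ≥0) < swallowingTime W y := lt_of_le_of_lt (WithTop.coe_le_coe.2 hst) hty
  rw [realFlow_sub_realFlow, realFlow_sub_realFlow, map_eq_of_isSolution hW hg hsx,
    map_eq_of_isSolution hW hg' hsy, map_eq_of_isSolution hW hg htx, map_eq_of_isSolution hW hg' hty]
  -- the gap `q u = re (g u) - re (g' u)` is monotone on `[0, t]`
  set q : ℝ → ℝ := fun u ↦ (g u).re - (g' u).re with hq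
  have htx' : ((t : ℝ).toNNReal : WithTop ℝ≥0) < swallowingTime W x := by simpa using htx
  have hty' : ((t : ℝ).toNNReal : WithTop ℝ≥0) < swallowingTime W y := by simpa using hty
  have hsubx := Icc_subset_timeDomain htx'
  have hsuby := Icc_subset_timeDomain hty'
  have hcont : ContinuousOn q (Icc 0 t) :=
    (continuous_re.comp_continuousOn (hg.continuousOn.mono hsubx)).sub
      (continuous_re.comp_continuousOn (hg'.continuousOn.mono hsuby))
  have hmono : MonotoneOn q (Icc 0 t) := by
    refine monotoneOn_of_hasDerivWithinAt_nonneg (convex_Icc (0 : ℝ) (t : ℝ)) hcont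
      (f' := fun u ↦ 2 / ((g u).re - W u.toNNReal) - 2 / ((g' u).re - W u.toNNReal)) ?_ ?_
    · intro u hu
      rw [interior_Icc] at hu ⊢
      have hux : (u.toNNReal : WithTop ℝ≥0) < swallowingTime W x := (hsubx ⟨hu.1.le, hu.2.le⟩).2
      have huy : (u.toNNReal : WithTop ℝ≥0) < swallowingTime W y := (hsuby ⟨hu.1.le, hu.2.le⟩).2
      exact ((hg.hasDerivAt_re hu.1 hux).sub (hg'.hasDerivAt_re hu.1 huy)).hasDerivWithinAt
    · intro u hu
      rw [interior_Icc] at hu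
      have hux : (u.toNNReal : WithTop ℝ≥0) < swallowingTime W x := (hsubx ⟨hu.1.le, hu.2.le⟩).2
      have huy : (u.toNNReal : WithTop ℝ≥0) < swallowingTime W y := (hsuby ⟨hu.1.le, hu.2.le⟩).2
      have hX : 0 < (g u).re - W u.toNNReal := sub_pos.2 (hg.driving_lt_re hW hx hu.1.le hux)
      have hY : (g' u).re - W u.toNNReal < 0 := by
        have h1 := realFlow_neg hW hy (t := u.toNNReal) huy
        rwa [realFlow_eq_re_sub hW hg' huy, Real.coe_toNNReal _ hu.1.le] at h1
      have h1 : 0 < 2 / ((g u).re - W u.toNNReal) := by positivity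
      have h2 : 2 / ((g' u).re - W u.toNNReal) < 0 := div_neg_of_pos_of_neg two_pos hY
      linarith
  have := hmono ⟨s.coe_nonneg, NNReal.coe_le_coe.2 hst⟩ ⟨t.coe_nonneg, le_rfl⟩ (NNReal.coe_le_coe.2 hst)
  simpa [hq] using this

/-- The gap is bounded below by its initial value: `x - y ≤ Xₜ - Yₜ` for `t < σ`.
[cite: Lawler2005, Prop. 6.33] -/
theorem sub_le_realFlow_sub_realFlow (hW : Continuous W) {x y : ℝ} (hx : W 0 < x) (hy : y < W 0)
    {t : ℝ≥0} (ht : (t : WithTop ℝ≥0) < twoPointTime W x y) :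
    x - y ≤ realFlow W x t - realFlow W y t := by
  have h := realFlow_sub_realFlow_mono hW hx hy (zero_le : (0 : ℝ≥0) ≤ t) ht
  rwa [realFlow_zero hW hx.ne', realFlow_zero hW hy.ne, show x - W 0 - (y - W 0) = x - y by ring]
    at h

/-- **`gₜ(x)` is non-decreasing in `t`** for a real point `x > W₀` (its time derivative is
`2/Xₜ > 0`). Lawler (2005), §1.10 / §4.1. [cite: Lawler2005, Ch. 4 §4.1] -/
theorem re_map_mono (hW : Continuous W) {x : ℝ} (hx : W 0 < x) {s t : ℝ≥0} (hst : s ≤ t)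
    (ht : (t : WithTop ℝ≥0) < swallowingTime W x) :
    (map W s x).re ≤ (map W t x).re := by
  have hx' : (x : ℂ) ≠ W 0 := fun h ↦ hx.ne' (by exact_mod_cast h)
  obtain ⟨g, hg⟩ := exists_isSolution_swallowingTime_holds hW hx'
  have hs : (s : WithTop ℝ≥0) < swallowingTime W x := lt_of_le_of_lt (WithTop.coe_le_coe.2 hst) ht
  rw [map_eq_of_isSolution hW hg hs, map_eq_of_isSolution hW hg ht]
  have ht' : ((t : ℝ).toNNReal : WithTop ℝ≥0) < swallowingTime W x := by simpa using ht
  have hsub := Icc_subset_timeDomain ht'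
  have hcont : ContinuousOn (fun u ↦ (g u).re) (Icc 0 t) :=
    continuous_re.comp_continuousOn (hg.continuousOn.mono hsub)
  have hmono : MonotoneOn (fun u ↦ (g u).re) (Icc 0 t) := by
    refine monotoneOn_of_hasDerivWithinAt_nonneg (convex_Icc (0 : ℝ) (t : ℝ)) hcont
      (f' := fun u ↦ 2 / ((g u).re - W u.toNNReal)) ?_ ?_
    · intro u hu
      rw [interior_Icc] at hu ⊢
      have hux : (u.toNNReal : WithTop ℝ≥0) < swallowingTime W x := (hsub ⟨hu.1.le, hu.2.le⟩).2
      exact (hg.hasDerivAt_re hu.1 hux).hasDerivWithinAt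
    · intro u hu
      rw [interior_Icc] at hu
      have hux : (u.toNNReal : WithTop ℝ≥0) < swallowingTime W x := (hsub ⟨hu.1.le, hu.2.le⟩).2
      have hX : 0 < (g u).re - W u.toNNReal := sub_pos.2 (hg.driving_lt_re hW hx hu.1.le hux)
      positivity
  exact hmono ⟨s.coe_nonneg, NNReal.coe_le_coe.2 hst⟩ ⟨t.coe_nonneg, le_rfl⟩ (NNReal.coe_le_coe.2 hst)

/-! ### The swallowed point reaches the driving function: `Xₜ → 0` as `t ↑ T_x` -/

/-- `liminf_{t ↑ T_x} Xₜ = 0`: if `T_x = b < ∞`, then on every final segment `[s, b)` the real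
flow `Xₜ` takes values `< ε` (contrapositive of the extension criterion
`IsSolution.coe_lt_swallowingTime_of_le_norm_sub`: otherwise `X` would be bounded below on
`[0, b)` and the solution would live beyond `b`). Lawler (2005), §4.1 ("`T_z` is the first time
`g_t(z) - W_t` hits `0`"). [cite: Lawler2005, Ch. 4 §4.1] -/
theorem exists_realFlow_lt (hW : Continuous W) {x : ℝ} (hx : W 0 < x) {b : ℝ≥0}
    (hb : swallowingTime W x = b) {ε : ℝ} (hε : 0 < ε) {s : ℝ≥0} (hs : s < b) :
    ∃ t : ℝ≥0, s ≤ t ∧ t < b ∧ realFlow W x t < ε := by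
  by_contra hcon
  push Not at hcon
  have hx' : (x : ℂ) ≠ W 0 := fun h ↦ hx.ne' (by exact_mod_cast h)
  obtain ⟨g, hg⟩ := exists_isSolution_swallowingTime_holds hW hx'
  rw [hb] at hg
  have hb0 : 0 < b := lt_of_le_of_lt (zero_le : (0 : ℝ≥0) ≤ s) hs
  -- on `[0, s]` the solution stays `δ`-away from `W`
  have hsT : ((s : ℝ).toNNReal : WithTop ℝ≥0) < (b : WithTop ℝ≥0) := by
    simpa using (WithTop.coe_lt_coe.2 hs)
  obtain ⟨δ, hδ, hfar⟩ := hg.exists_le_norm_sub hW s.coe_nonneg hsT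
  -- hence `min δ ε`-away on all of `[0, b)`
  set δ' : ℝ≥0 := min δ ⟨ε, hε.le⟩ with hδ'
  have hδ'pos : 0 < δ' := lt_min hδ (by exact_mod_cast hε)
  have hfar' : ∀ t : ℝ, 0 ≤ t → t < b → (δ' : ℝ) ≤ ‖g t - W t.toNNReal‖ := by
    intro t ht0 htb
    rcases le_or_gt t s with hts | hts
    · exact (min_le_left _ _).trans (hfar t ⟨ht0, hts⟩)
    · have htT : ((t.toNNReal : ℝ≥0) : WithTop ℝ≥0) < swallowingTime W x := by
        rw [hb, WithTop.coe_lt_coe]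
        exact (Real.toNNReal_lt_iff_lt_coe ht0).2 htb
      have h1 := hcon t.toNNReal ((Real.lt_toNNReal_iff_coe_lt.2 hts).le)
        ((Real.toNNReal_lt_iff_lt_coe ht0).2 htb)
      rw [realFlow_eq_re_sub hW (hb ▸ hg) htT, Real.coe_toNNReal t ht0] at h1
      have him : (g t).im = 0 :=
        IsSolution.im_eq_zero_holds hg (ofReal_im x) t ht0 (by
          rw [WithTop.coe_lt_coe]; exact (Real.toNNReal_lt_iff_lt_coe ht0).2 htb)
      rw [norm_sub_driving_of_im_eq_zero him]
      calc ((δ' : ℝ≥0) : ℝ) ≤ ε := by exact_mod_cast (min_le_right δ ⟨ε, hε.le⟩)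
        _ ≤ (g t).re - W t.toNNReal := h1
        _ ≤ |(g t).re - W t.toNNReal| := le_abs_self _
  have := hg.coe_lt_swallowingTime_of_le_norm_sub hW hb0 hδ'pos hfar'
  rw [hb] at this
  exact lt_irrefl _ this

/-- **The swallowed point reaches the driving function**: if `x > W₀` is swallowed at the finite
time `T_x = b`, then `Xₜ = gₜ(x) - Wₜ → 0` as `t ↑ b`, in the form: for every `ε > 0` there is
`s < b` with `Xₜ < ε` for all `t ∈ [s, b)` (recall `Xₜ > 0` there). Proof: `liminf = 0`
(`exists_realFlow_lt`), `gₜ(x)` is non-decreasing (`re_map_mono`) and `W` is uniformly continuous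
on `[0, b]`, so `Xₜ ≤ X_{t'} + |W_{t'} - W_t|` for `t ≤ t'`. Lawler (2005), p. 154: "the time `T_z`
satisfies `lim_{t→T_z-} ĝ_t(z) = 0`" (in the normalisation `ĝ = g - W`). [cite: Lawler2005, Ch. 4 §4.1] -/
theorem realFlow_lt_of_near_swallowingTime (hW : Continuous W) {x : ℝ} (hx : W 0 < x) {b : ℝ≥0}
    (hb : swallowingTime W x = b) {ε : ℝ} (hε : 0 < ε) :
    ∃ s : ℝ≥0, s < b ∧ ∀ t : ℝ≥0, s ≤ t → t < b → realFlow W x t < ε := by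
  have hx' : (x : ℂ) ≠ W 0 := fun h ↦ hx.ne' (by exact_mod_cast h)
  have hb0 : 0 < b := by
    have := swallowingTime_pos_holds hW hx'
    rwa [hb, WithTop.coe_pos] at this
  -- uniform continuity of `W` on `[0, b]`
  obtain ⟨η, hη, hmod⟩ := exists_forall_abs_sub_driving_le hW b (η := ε / 2) (by positivity)
  set s : ℝ≥0 := ((b : ℝ) - η).toNNReal with hsdef
  have hsb : s < b := by
    rcases le_or_gt 0 ((b : ℝ) - η) with h | h
    · exact (Real.toNNReal_lt_iff_lt_coe h).2 (by linarith)
    · rw [hsdef, Real.toNNReal_of_nonpos h.le]; exact hb0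
  refine ⟨s, hsb, fun t hst htb ↦ ?_⟩
  obtain ⟨t', htt', ht'b, hX'⟩ := exists_realFlow_lt hW hx hb (half_pos hε) htb
  have ht'T : (t' : WithTop ℝ≥0) < swallowingTime W x := by rw [hb]; exact_mod_cast ht'b
  -- `X t ≤ X t' + (W t' - W t)`
  have hG := re_map_mono hW hx htt' ht'T
  have hWdiff : |W t' - W t| ≤ ε / 2 := by
    have h1 : ((b : ℝ) - η) ≤ t := (Real.le_coe_toNNReal _).trans (NNReal.coe_le_coe.2 hst)
    have := hmod t' ⟨t'.coe_nonneg, NNReal.coe_le_coe.2 ht'b.le⟩ t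
      ⟨t.coe_nonneg, NNReal.coe_le_coe.2 htb.le⟩ (by
        rw [abs_of_nonneg (sub_nonneg.2 (NNReal.coe_le_coe.2 htt'))]
        have : (t' : ℝ) ≤ b := NNReal.coe_le_coe.2 ht'b.le
        linarith)
    simpa using this
  have h2 : realFlow W x t ≤ realFlow W x t' + (W t' - W t) := by
    simp only [realFlow]
    linarith
  linarith [(abs_le.1 hWdiff).2]

/-! ### The limits `Z_{σ-} ∈ {0, 1}` and `T_x ≠ T_y` -/

/-- **`Zₜ → 0` as `t ↑ T_x` when `x` is swallowed first** (`T_x = b ≤ T_y`): for every `ε > 0`,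
`Zₜ < ε` on a final segment `[s, b)` (`Z = X/(X - Y)` with `X → 0` and `X - Y ≥ x - y > 0`).
Lawler (2005), proof of Prop. 6.33 (`σ` = first time `Z ∈ {0,1}`; `{Z_σ = 0} = {T_1 < T_{-y}}`).
[cite: Lawler2005, Prop. 6.33] -/
theorem twoPointRatio_lt_of_near (hW : Continuous W) {x y : ℝ} (hx : W 0 < x) (hy : y < W 0)
    {b : ℝ≥0} (hbx : swallowingTime W x = b) (hby : (b : WithTop ℝ≥0) ≤ swallowingTime W y)
    {ε : ℝ} (hε : 0 < ε) :
    ∃ s : ℝ≥0, s < b ∧ ∀ t : ℝ≥0, s ≤ t → t < b → twoPointRatio W x y t < ε := by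
  have hxy : 0 < x - y := by linarith
  obtain ⟨s, hsb, hs⟩ := realFlow_lt_of_near_swallowingTime hW hx hbx (mul_pos hε hxy)
  refine ⟨s, hsb, fun t hst htb ↦ ?_⟩
  have htσ : (t : WithTop ℝ≥0) < twoPointTime W x y := by
    refine coe_lt_twoPointTime_iff.2 ⟨?_, ?_⟩
    · rw [hbx]; exact_mod_cast htb
    · exact lt_of_lt_of_le (by exact_mod_cast htb) hby
  obtain ⟨htx, -⟩ := coe_lt_twoPointTime_iff.1 htσ
  have hX := realFlow_pos hW hx htx
  have hQ := sub_le_realFlow_sub_realFlow hW hx hy htσ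
  rw [twoPointRatio]
  calc realFlow W x t / (realFlow W x t - realFlow W y t)
      ≤ realFlow W x t / (x - y) := div_le_div_of_nonneg_left hX.le hxy hQ
    _ < ε * (x - y) / (x - y) := div_lt_div_of_pos_right (hs t hst htb) hxy
    _ = ε := mul_div_cancel_right₀ ε hxy.ne'

/-- **`Zₜ → 1` as `t ↑ T_y` when `y` is swallowed first** (`T_y = b ≤ T_x`): for every `ε > 0`,
`1 - Zₜ < ε` on a final segment `[s, b)` (reflection of `twoPointRatio_lt_of_near`).
[cite: Lawler2005, Prop. 6.33] -/
theorem one_sub_twoPointRatio_lt_of_near (hW : Continuous W) {x y : ℝ} (hx : W 0 < x)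
    (hy : y < W 0) {b : ℝ≥0} (hby : swallowingTime W y = b)
    (hbx : (b : WithTop ℝ≥0) ≤ swallowingTime W x) {ε : ℝ} (hε : 0 < ε) :
    ∃ s : ℝ≥0, s < b ∧ ∀ t : ℝ≥0, s ≤ t → t < b → 1 - twoPointRatio W x y t < ε := by
  have hW' : Continuous fun s ↦ -W s := hW.neg
  have hx' : (fun s ↦ -W s) 0 < -y := by simpa using hy
  have hy' : -x < (fun s ↦ -W s) 0 := by simpa using hx
  have hbx' : swallowingTime (fun s ↦ -W s) ((-y : ℝ) : ℂ) = b := by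
    rw [swallowingTime_neg_ofReal, hby]
  have hby' : (b : WithTop ℝ≥0) ≤ swallowingTime (fun s ↦ -W s) ((-x : ℝ) : ℂ) := by
    rwa [swallowingTime_neg_ofReal]
  obtain ⟨s, hsb, hs⟩ := twoPointRatio_lt_of_near hW' hx' hy' hbx' hby' hε
  refine ⟨s, hsb, fun t hst htb ↦ ?_⟩
  have htσ : (t : WithTop ℝ≥0) < twoPointTime W x y := by
    refine coe_lt_twoPointTime_iff.2 ⟨?_, ?_⟩
    · exact lt_of_lt_of_le (by exact_mod_cast htb) hbx
    · rw [hby]; exact_mod_cast htb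
  rw [← twoPointRatio_reflect hW hx hy htσ]
  exact hs t hst htb

/-- **Points on opposite sides of the driving point are not swallowed simultaneously**: for a
continuous driving function and `y < W₀ < x`, if `σ = T_x ⊓ T_y < ∞` then `T_x ≠ T_y` (near a
common swallowing time `Z` would have to tend both to `0` and to `1`; equivalently, the gap
`X - Y ≥ x - y` cannot collapse). Implicit in Lawler (2005), proof of Prop. 6.33 ("`σ` = the first
time `Z_t ∈ {0, 1}`", `P{Z_σ = 1} + P{Z_σ = 0} = 1`). [cite: Lawler2005, Prop. 6.33] -/
theorem swallowingTime_ne_swallowingTime (hW : Continuous W) {x y : ℝ} (hx : W 0 < x)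
    (hy : y < W 0) (hσ : twoPointTime W x y < ⊤) :
    swallowingTime W x ≠ swallowingTime W y := by
  intro heq
  have hTx : swallowingTime W x ≠ ⊤ := by
    have : twoPointTime W x y = swallowingTime W x := by rw [twoPointTime, heq, min_self]
    rw [← this]; exact hσ.ne
  obtain ⟨b, hb⟩ := WithTop.ne_top_iff_exists.1 hTx
  have hbx : swallowingTime W x = b := hb.symm
  have hby : swallowingTime W y = b := heq ▸ hbx
  obtain ⟨s₁, hs₁, h₁⟩ := twoPointRatio_lt_of_near hW hx hy hbx hby.ge (ε := 1 / 2) one_half_pos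
  obtain ⟨s₂, hs₂, h₂⟩ := one_sub_twoPointRatio_lt_of_near hW hx hy hby hbx.ge (ε := 1 / 2)
    one_half_pos
  have h1 := h₁ (max s₁ s₂) (le_max_left _ _) (max_lt hs₁ hs₂)
  have h2 := h₂ (max s₁ s₂) (le_max_right _ _) (max_lt hs₁ hs₂)
  linarith

/-- Variant: if `T_x < ∞` (e.g. almost surely for SLE_κ, `κ > 4`) then `T_x ≠ T_y`.
[cite: Lawler2005, Prop. 6.33] -/
theorem swallowingTime_ne_swallowingTime_of_lt_top (hW : Continuous W) {x y : ℝ} (hx : W 0 < x)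
    (hy : y < W 0) (hTx : swallowingTime W x < ⊤) :
    swallowingTime W x ≠ swallowingTime W y :=
  swallowingTime_ne_swallowingTime hW hx hy ((twoPointTime_le_left x y).trans_lt hTx)

end Loewner

/-! ### Specialisation to the SLE_κ driving function `√κ B(ω)` (`W₀ = 0`) -/

section SLE

open Loewner

variable {κ : ℝ≥0} {x y : ℝ}

/-- For SLE_κ (`W₀ = 0`) and `y < 0 < x`: `0 < σ` for every sample path. [folklore] -/
theorem sle_twoPointTime_pos (hx : 0 < x) (hy : y < 0) (ω : ℝ≥0 → ℝ) :
    0 < twoPointTime (sleDriving κ ω) x y :=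
  twoPointTime_pos (continuous_sleDriving κ ω) (by rwa [sleDriving_zero]) (by rwa [sleDriving_zero])

/-- For SLE_κ and `y < 0 < x`: `Zₜ ∈ (0, 1)` for `t < σ`, every sample path.
[cite: Lawler2005, Prop. 6.33] -/
theorem sle_twoPointRatio_mem_Ioo (hx : 0 < x) (hy : y < 0) {ω : ℝ≥0 → ℝ} {t : ℝ≥0}
    (ht : (t : WithTop ℝ≥0) < twoPointTime (sleDriving κ ω) x y) :
    twoPointRatio (sleDriving κ ω) x y t ∈ Ioo (0 : ℝ) 1 :=
  twoPointRatio_mem_Ioo (continuous_sleDriving κ ω) (by rwa [sleDriving_zero])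
    (by rwa [sleDriving_zero]) ht

/-- For SLE_κ and `y < 0 < x`: `Z₀ = x/(x - y)`, every sample path. [cite: Lawler2005, Prop. 6.33] -/
theorem sle_twoPointRatio_zero (hx : 0 < x) (hy : y < 0) (ω : ℝ≥0 → ℝ) :
    twoPointRatio (sleDriving κ ω) x y 0 = x / (x - y) := by
  rw [twoPointRatio_zero (continuous_sleDriving κ ω) (by rwa [sleDriving_zero])
    (by rwa [sleDriving_zero]), sleDriving_zero, sub_zero]

/-- For SLE_κ and `y < 0 < x`: if `T_x(ω) < ∞` then `T_x(ω) ≠ T_y(ω)`. [cite: Lawler2005, Prop. 6.33] -/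
theorem sle_swallowingTime_ne (hx : 0 < x) (hy : y < 0) {ω : ℝ≥0 → ℝ}
    (hT : swallowingTime (sleDriving κ ω) x < ⊤) :
    swallowingTime (sleDriving κ ω) x ≠ swallowingTime (sleDriving κ ω) y :=
  swallowingTime_ne_swallowingTime_of_lt_top (continuous_sleDriving κ ω) (by rwa [sleDriving_zero])
    (by rwa [sleDriving_zero]) hT

/-- **The two-point observable starts at `Ψ_{2/κ}(x/(x-y))`**, for every sample path
(`0 < σ` and `Z₀ = x/(x-y)`). Lawler (2005), proof of Prop. 6.33 (`ψ(y/(y+1))`, resp. `ψ(1/(1+y))`,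
for the points `1`, `-y`). [cite: Lawler2005, Prop. 6.33] -/
theorem sleTwoPointObservable_zero (hx : 0 < x) (hy : y < 0) (ω : ℝ≥0 → ℝ) :
    sleTwoPointObservable κ x y 0 ω = swallowingProb (2 / (κ : ℝ)) (x / (x - y)) := by
  rw [sleTwoPointObservable_of_lt (by exact_mod_cast sle_twoPointTime_pos hx hy ω),
    sle_twoPointRatio_zero hx hy]

/-- **Eventual value of the observable**: if `T_x(ω) < ∞`, then for all `t ≥ σ(ω)` the observable
equals the crossing indicator `𝟙{T_y < T_x}(ω)` (by definition of the regularisation).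
[cite: Lawler2005, Prop. 6.33] -/
theorem sleTwoPointObservable_of_le {ω : ℝ≥0 → ℝ} {t : ℝ≥0}
    (ht : twoPointTime (sleDriving κ ω) x y ≤ t) :
    sleTwoPointObservable κ x y t ω =
      if swallowingTime (sleDriving κ ω) y < swallowingTime (sleDriving κ ω) x then 1 else 0 := by
  split_ifs with h
  · exact sleTwoPointObservable_of_le_of_lt ht h
  · exact sleTwoPointObservable_of_le_of_not_lt ht h

end SLE

end Literature.Probability.RandomPlanarGeometry
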